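import Summits.HubbardSuperconductivity.HubbardSuperconductivity.Theorems.AposterioriCapRgSsbToEvenTorusLroFacePurityOfRepelledOrder
import Summits.HubbardSuperconductivity.HubbardSuperconductivity.Theorems.AposterioriCapRgSsbToEvenTorusLroGlue
import HarnessLib

/-!
# Route `AposterioriCapRg` — crux `SsbToEvenTorusLro` (stmt-HubbardSuperconductivity-1315),
# line `pair-yrast-landau-floor`: the SOURCE-FREE, TRACIAL door for the every-ground-state half

The registered open stub `stub_facePurity` (FP, derivative face purity: every normalised `(N_L, S^z = 0)`-sector
ground state of the pure torus has block pair coherence `Re⟨ψ, W_R ψ⟩ ≥ a L²` at every fixed block scale `R`) is the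
every-ground-state half of the crux (NECESSARY, `facePurity_of_hasDWavePairFieldLROAt`; sufficient together with the
infrared half, `SsbToEvenTorusLro_of_facePurity_of_infraredCeiling`). Its only landed supplier so far was REPELLED
ORDER PERSISTENCE (ROP, `stub_facePurity_of_repelledOrderPersistence`, p90057): Koma–Tasaki `d`-wave order of the
block-repelled SOURCED model `K_μ + κW_R − h(Δ+Δᴴ)` with three nested limits (`L → ∞` at fixed `h`, then `h ↓ 0`,
uniformly in `R`).

This file lands a SECOND, simpler supplier: REPELLED PAIR COHERENCE (RPC) — a statement about the SOURCE-FREE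
block-repelled grand-canonical model `K_μ + κ W_R` ALONE, with NO symmetry-breaking field and NO order of limits:

  `∃ c > 0, ∀ R ≥ 1, ∃ κ > 0, eventually along even sides L:  c·L² ≤ Re ω₀[K_μ + κ W_R](W_R)`,

`ω₀` the tracial ground-state functional (uniform mixture of ground states — no "every ground state" clause),
`W_R = R⁻⁴ Σ_a B_aᴴ B_a`, `B_a = Σ_{u ∈ [0,R)²} P_{a+u}`, `P_y = localPair dWaveFormFactor L y`. In words: the
grand-canonical ground states of the Hubbard torus perturbed by a small REPULSIVE Kac block-pair term keep a positive
density of local `d`-wave pair coherence, with a floor uniform in the block scale.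

* `rpc_groundEnergy_chord_ge` — the one-line variational slope behind it: for Hermitian `K, W` and real `κ`,
  `κ · Re ω₀[K + κW](W) ≤ E₀(K + κW) − E₀(K)` (the tracial ground state of `K + κW` is a trial state for `K`).
* `fp_chord_of_repelledCoherenceAt` — POINTWISE at `(U, δ, μ)`, `δ ∈ (0,1)`: grand-canonical density matching at `μ`
  + the RPC floor at `(U, μ)` ⇒ the CHORD form of face purity at `(U, δ)` (floor `c/2`), from the landed `T = 0`
  equivalence of ensembles (`CwSsbToEvenTorusLRO.stub_canonicalSupportingPotential` + Griffiths recentring,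
  `fp_canonicalGCEquivalence_of_csp_of_densityMatched`) and the landed sector floor `CwSsbToEvenTorusLRO.stub_sectorFloorGC`.
* `facePurity_of_repelledCoherenceAt` — chord ⇒ derivative face purity (landed `deriv_of_chord`): EXACTLY the
  consequent of `stub_facePurity` at `(U, δ)`.
* `stub_facePurity_of_repelledCoherence` — the registered signature of `stub_facePurity` VERBATIM from the guarded
  (`∀ U > 0, δ ∈ (0,1)`, density-matched, ordered) RPC hypothesis; `SsbToEvenTorusLro_of_repelledCoherence_of_infraredCeiling`
  — door 4 of the line: the crux BY NAME from RPC and the infrared ceiling.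

Why this is the right shape of the every-GS residue (documented in the line dossier `PROMOTE-stub_repelledCoherence.md`):
RPC is `h`-free and tracial, it is a ground-state expectation of a LOCAL positive observable in a LOCAL Hamiltonian,
and it fails exactly where the crux fails (iso-density coexistence of the `d`-wave phase with a pair-INCOHERENT phase at
the same `μ`); it does not ask the ORDER to survive the repulsion (phase-disordered but locally paired states still
satisfy it), only the local pair coherence. RPC is OPEN PHYSICS and is NOT filed as an item; here it only ever appears
as an explicit hypothesis.

Folklore bookkeeping over the finite-dimensional variational principle (Tasaki 2020 §2.1–2.2; Ruelle 1969 §3.4 for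
the equivalence of ensembles, used only through the landed S3). No definition is introduced.
-/

noncomputable section

namespace Summit.HubbardSuperconductivity.HubbardSuperconductivity.Theorems

set_option linter.dupNamespace false

open Literature.MathematicalPhysics.QuantumLattice Literature.Probability.LatticeModels
open Literature.Barriers.HubbardSuperconductivity
open Filter Set Matrix
open scoped Matrix ComplexOrder
open _root_.Topology
open Summit.HubbardSuperconductivity.WcbcsSsbToTorusLRO.Negative
  (deriv_of_chord exists_unit_groundStateInSector halfFilling_floor_le_sq)
open Summit.HubbardSuperconductivity.HubbardSuperconductivity.Theorems.CwSsbToEvenTorusLRO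
  (stub_sectorFloorGC stub_canonicalSupportingPotential)
open Summit.HubbardSuperconductivity.HubbardSuperconductivity.Theses.AposterioriCapRg (SsbToEvenTorusLro)

/-! ## The variational slope -/

/-- **Variational slope of a linear perturbation.** For Hermitian `K`, `W` and real `κ`, the tracial ground state of
`K + κW` is a trial state for `K`: `E₀(K) ≤ ω₀[K+κW](K) = E₀(K + κW) − κ · Re ω₀[K+κW](W)`, i.e.
`κ · Re ω₀[K + κW](W) ≤ E₀(K + κW) − E₀(K)`. (Tasaki 2020 §2.1, (2.1.6).) [folklore] -/
theorem rpc_groundEnergy_chord_ge {n : Type*} [Fintype n] [DecidableEq n] [Nonempty n]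
    {K W : Matrix n n ℂ} (hK : K.IsHermitian) (hW : W.IsHermitian) (κ : ℝ) :
    κ * ((K + (κ : ℂ) • W).groundStateFunctional W).re ≤
      (K + (κ : ℂ) • W).groundEnergy - K.groundEnergy := by
  have hA : (K + (κ : ℂ) • W).IsHermitian := by
    refine hK.add (IsHermitian.smul hW ?_)
    rw [isSelfAdjoint_iff, Complex.star_def, Complex.conj_ofReal]
  have h1 := groundEnergy_le_groundStateFunctional_re hA hK
  have hAK : K + (κ : ℂ) • W - (κ : ℂ) • W = K := add_sub_cancel_right K ((κ : ℂ) • W)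
  have h2 : (K + (κ : ℂ) • W).groundStateFunctional (K + (κ : ℂ) • W - (κ : ℂ) • W) =
      (K + (κ : ℂ) • W).groundStateFunctional (K + (κ : ℂ) • W) -
        (κ : ℂ) * (K + (κ : ℂ) • W).groundStateFunctional W := by
    rw [map_sub, map_smul, smul_eq_mul]
  rw [hAK, groundStateFunctional_hamiltonian hA] at h2
  rw [h2, Complex.sub_re, Complex.ofReal_re, Complex.re_ofReal_mul] at h1
  linarith

/-! ## Pointwise: density matching + repelled pair coherence ⇒ the chord form of face purity -/

/-- **Pointwise chord from repelled pair coherence (sorry-free).** At one parameter `(U, δ, μ)` with `δ ∈ (0,1)`: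
grand-canonical density matching at `μ` and the source-free REPELLED PAIR COHERENCE floor at `(U, μ)` — one `c > 0`
such that for every block scale `R ≥ 1` some coupling `κ > 0` keeps `Re ω₀[K_μ + κW_R](W_R) ≥ c L²` eventually along
the even sides `L = 2k+2` (tracial ground-state functional of the block-repelled grand-canonical torus, NO source) —
give the CHORD form of face purity at `(U, δ)` with floor `c/2`: `κ (c/2) L² ≤ E_sec(H + κW_R)(N_L, 0) − E_sec(H)(N_L, 0)`
eventually along even sides. Proof: `E_sec(H+κW_R)(N_L) − μN_L ≥ E₀(K_μ + κW_R)` (landed `stub_sectorFloorGC`),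
`E_sec(H)(N_L) − μN_L ≤ E₀(K_μ) + (κc/2)L²` (landed `T = 0` equivalence of ensembles,
`fp_canonicalGCEquivalence_of_csp_of_densityMatched`), and `E₀(K_μ + κW_R) − E₀(K_μ) ≥ κ Re ω₀[K_μ+κW_R](W_R) ≥ κcL²`
(`rpc_groundEnergy_chord_ge`). [folklore] -/
theorem fp_chord_of_repelledCoherenceAt {U δ μ : ℝ} (hδ : δ ∈ Set.Ioo (0:ℝ) 1)
    (hdm : Filter.Tendsto (fun L : ℕ => ((hubbardTorusWith 2 (L + 1) 1 U μ).groundStateFunctional totalNumber).re / ((L + 1 : ℕ) : ℝ) ^ 2) Filter.atTop (nhds (1 - δ)))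
    (hC : ∃ c : ℝ, 0 < c ∧ ∀ R : ℕ, 0 < R → ∃ κ : ℝ, 0 < κ ∧ ∀ᶠ k : ℕ in Filter.atTop, c * ((2 * k + 1 + 1 : ℕ) : ℝ) ^ 2 ≤ ((hubbardTorusWith 2 (2 * k + 1 + 1) 1 U μ + (κ : ℂ) • (((((R : ℝ) ^ 4)⁻¹ : ℝ) : ℂ) • ∑ a : Literature.Probability.LatticeModels.TorusSite 2 (2 * k + 1 + 1), (∑ u : Fin 2 → Fin R, localPair dWaveFormFactor (2 * k + 1 + 1) (a + fun i => ((u i : ℕ) : ZMod (2 * k + 1 + 1))))ᴴ * (∑ u : Fin 2 → Fin R, localPair dWaveFormFactor (2 * k + 1 + 1) (a + fun i => ((u i : ℕ) : ZMod (2 * k + 1 + 1)))))).groundStateFunctional (((((R : ℝ) ^ 4)⁻¹ : ℝ) : ℂ) • ∑ a : Literature.Probability.LatticeModels.TorusSite 2 (2 * k + 1 + 1), (∑ u : Fin 2 → Fin R, localPair dWaveFormFactor (2 * k + 1 + 1) (a + fun i => ((u i : ℕ) : ZMod (2 * k + 1 + 1))))ᴴ * (∑ u : Fin 2 → Fin R,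 localPair dWaveFormFactor (2 * k + 1 + 1) (a + fun i => ((u i : ℕ) : ZMod (2 * k + 1 + 1)))))).re) :
    (∃ a : ℝ, 0 < a ∧ ∀ R : ℕ, 0 < R → ∃ κ : ℝ, 0 < κ ∧ ∀ᶠ k : ℕ in Filter.atTop,
    κ * a * ((2 * k + 1 + 1 : ℕ) : ℝ) ^ 2 ≤
      (hubbardTorus 2 (2 * k + 1 + 1) 1 U + (κ : ℂ) • (((((R : ℝ) ^ 4)⁻¹ : ℝ) : ℂ) • ∑ a : Literature.Probability.LatticeModels.TorusSite 2 (2 * k + 1 + 1), ((∑ u : Fin 2 → Fin R, localPair dWaveFormFactor ((2 * k + 1 + 1)) (a + fun i => ((u i : ℕ) : ZMod ((2 * k + 1 + 1))))))ᴴ * ((∑ u : Fin 2 → Fin R, localPair dWaveFormFactor ((2 * k + 1 + 1)) (a + fun i => ((u i : ℕ) : ZMod ((2 * k + 1 + 1)))))))).minEnergyOn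
          (szSector (2 * ⌊(1 - δ) * (((2 * k + 1 + 1) : ℕ) : ℝ) ^ 2 / 2⌋₊) 0) -
        (hubbardTorus 2 (2 * k + 1 + 1) 1 U).minEnergyOn (szSector (2 * ⌊(1 - δ) * (((2 * k + 1 + 1) : ℕ) : ℝ) ^ 2 / 2⌋₊) 0)) := by
  obtain ⟨c, hc, hC⟩ := hC
  have hδ1 : δ ≤ 1 := hδ.2.le
  have hδ0 : 0 ≤ δ := hδ.1.le
  have hcge := fp_canonicalGCEquivalence_of_csp_of_densityMatched (U := U) (μ := μ) hδ1
    (stub_canonicalSupportingPotential U δ hδ) hdm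
  refine ⟨c / 2, by positivity, fun R hR => ?_⟩
  obtain ⟨κ, hκ, hk⟩ := hC R hR
  refine ⟨κ, hκ, ?_⟩
  obtain ⟨L₁, hL₁⟩ := hcge (κ * c / 2) (by positivity)
  filter_upwards [hk, eventually_ge_atTop L₁] with k hk hkL
  have hEven : Even (2 * k + 1 + 1) := ⟨k + 1, by ring⟩
  have hL₁' : L₁ ≤ 2 * k + 1 + 1 := by omega
  -- canonical/GC equivalence at resolution κc/2
  have hcgek := hL₁ (2 * k + 1 + 1) hL₁' hEven
  -- the repelled block operator and the repelled grand-canonical Hamiltonian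
  set W : Matrix (Finset (Orb (FermionTorus 2 (2 * k + 1 + 1)))) (Finset (Orb (FermionTorus 2 (2 * k + 1 + 1)))) ℂ :=
    ((((R : ℝ) ^ 4)⁻¹ : ℝ) : ℂ) • ∑ a : Literature.Probability.LatticeModels.TorusSite 2 (2 * k + 1 + 1), (∑ u : Fin 2 → Fin R, localPair dWaveFormFactor (2 * k + 1 + 1) (a + fun i => ((u i : ℕ) : ZMod (2 * k + 1 + 1))))ᴴ * (∑ u : Fin 2 → Fin R, localPair dWaveFormFactor (2 * k + 1 + 1) (a + fun i => ((u i : ℕ) : ZMod (2 * k + 1 + 1)))) with hW_def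
  have hWh : W.IsHermitian := by
    refine IsHermitian.smul ?_ ?_
    · exact (isSelfAdjoint_sum _ fun a _ =>
        (isHermitian_conjTranspose_mul_self _).isSelfAdjoint).isHermitian
    · rw [isSelfAdjoint_iff, Complex.star_def, Complex.conj_ofReal]
  -- S5: the repelled grand-canonical energy is below the repelled sector energy (sector N_L non-empty)
  have hne : ∃ φ : Fock (Orb (FermionTorus 2 (2 * k + 1 + 1))),
      φ ∈ szSector (2 * ⌊(1 - δ) * (((2 * k + 1 + 1 : ℕ) : ℝ)) ^ 2 / 2⌋₊) 0 ∧ φ ≠ 0 := by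
    obtain ⟨ψ, -, hψ⟩ := exists_unit_groundStateInSector (2 * k + 1 + 1) U
      (halfFilling_floor_le_sq (2 * k + 1 + 1) hδ0)
    exact ⟨ψ, hψ.1, hψ.2.1⟩
  have hS5 := stub_sectorFloorGC (2 * k + 1 + 1) R U μ κ _ hne
  -- the variational slope of the repulsion
  have hvar := rpc_groundEnergy_chord_ge (isHermitian_hubbardTorusWith (L := 2 * k + 1 + 1) 1 U μ) hWh κ
  -- the coherence floor, multiplied by κ
  have hkκ : κ * (c * ((2 * k + 1 + 1 : ℕ) : ℝ) ^ 2) ≤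
      κ * ((hubbardTorusWith 2 (2 * k + 1 + 1) 1 U μ + (κ : ℂ) • W).groundStateFunctional W).re :=
    mul_le_mul_of_nonneg_left hk hκ.le
  -- bookkeeping
  have e : κ * (c / 2) * ((2 * k + 1 + 1 : ℕ) : ℝ) ^ 2 =
      κ * (c * ((2 * k + 1 + 1 : ℕ) : ℝ) ^ 2) - κ * c / 2 * ((2 * k + 1 + 1 : ℕ) : ℝ) ^ 2 := by ring
  rw [e]
  linarith [hS5, hvar, hkκ, hcgek]

/-! ## Derivative face purity (the stub's consequent) from repelled pair coherence -/

/-- **Derivative face purity at `(U, δ)` from repelled pair coherence at `(U, μ)` (sorry-free reduction, pointwise, no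
window, no source).** For `δ ∈ (0,1)`: density matching at `μ` and the RPC floor at `(U, μ)` imply EXACTLY the
consequent of the registered stub `stub_facePurity` at `(U, δ)` — one `a > 0` (`= c/2`) such that at every block
scale `R ≥ 1`, eventually along even sides, every normalised `(N_L, S^z = 0)`-sector ground state has block pair
coherence `Re⟨ψ, W_R ψ⟩ ≥ a L²` (`fp_chord_of_repelledCoherenceAt`, then the landed `deriv_of_chord`). [folklore] -/
theorem facePurity_of_repelledCoherenceAt {U δ μ : ℝ} (hδ : δ ∈ Set.Ioo (0:ℝ) 1)
    (hdm : Filter.Tendsto (fun L : ℕ => ((hubbardTorusWith 2 (L + 1) 1 U μ).groundStateFunctional totalNumber).re / ((L + 1 : ℕ) : ℝ) ^ 2) Filter.atTop (nhds (1 - δ)))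
    (hC : ∃ c : ℝ, 0 < c ∧ ∀ R : ℕ, 0 < R → ∃ κ : ℝ, 0 < κ ∧ ∀ᶠ k : ℕ in Filter.atTop, c * ((2 * k + 1 + 1 : ℕ) : ℝ) ^ 2 ≤ ((hubbardTorusWith 2 (2 * k + 1 + 1) 1 U μ + (κ : ℂ) • (((((R : ℝ) ^ 4)⁻¹ : ℝ) : ℂ) • ∑ a : Literature.Probability.LatticeModels.TorusSite 2 (2 * k + 1 + 1), (∑ u : Fin 2 → Fin R, localPair dWaveFormFactor (2 * k + 1 + 1) (a + fun i => ((u i : ℕ) : ZMod (2 * k + 1 + 1))))ᴴ * (∑ u : Fin 2 → Fin R, localPair dWaveFormFactor (2 * k + 1 + 1) (a + fun i => ((u i : ℕ) : ZMod (2 * k + 1 + 1)))))).groundStateFunctional (((((R : ℝ) ^ 4)⁻¹ : ℝ) : ℂ) • ∑ a : Literature.Probability.LatticeModels.TorusSite 2 (2 * k + 1 + 1), (∑ u : Fin 2 → Fin R, localPair dWaveFormFactor (2 * k + 1 + 1) (a + fun i => ((u i : ℕ) : ZMod (2 * k + 1 + 1))))ᴴ * (∑ u : Fin 2 → Fin R,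 localPair dWaveFormFactor (2 * k + 1 + 1) (a + fun i => ((u i : ℕ) : ZMod (2 * k + 1 + 1)))))).re) :
    ∃ a : ℝ, 0 < a ∧ ∀ R : ℕ, 0 < R → ∀ᶠ k : ℕ in Filter.atTop, ∀ ψ : Fock (Orb (FermionTorus 2 (2 * k + 1 + 1))), IsGroundStateInSector (hubbardTorus 2 (2 * k + 1 + 1) 1 U) (2 * ⌊(1 - δ) * ((2 * k + 1 + 1 : ℕ) : ℝ) ^ 2 / 2⌋₊) 0 ψ → star ψ ⬝ᵥ ψ = 1 → a * ((2 * k + 1 + 1 : ℕ) : ℝ) ^ 2 ≤ (star ψ ⬝ᵥ ((((((R : ℝ) ^ 4)⁻¹ : ℝ) : ℂ) • ∑ x : TorusSite 2 (2 * k + 1 + 1), (∑ u : Fin 2 → Fin R, localPair dWaveFormFactor (2 * k + 1 + 1) (x + fun i => ((u i : ℕ) : ZMod (2 * k + 1 + 1))))ᴴ * (∑ u : Fin 2 → Fin R, localPair dWaveFormFactor (2 * k + 1 + 1) (x + fun i => ((u i : ℕ) : ZMod (2 * k + 1 + 1))))) *ᵥ ψ)).re :=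
  deriv_of_chord (fp_chord_of_repelledCoherenceAt hδ hdm hC)

/-- **The registered stub `stub_facePurity` from REPELLED PAIR COHERENCE (sorry-free reduction; door 4 antecedent).**
The antecedent is the guarded (`∀ U > 0`, `δ ∈ (0,1)`, density-matched, Koma–Tasaki-ordered) SOURCE-FREE, TRACIAL
repelled-pair-coherence floor: one `c > 0` such that at every block scale `R ≥ 1` some repulsive block coupling
`κ > 0` keeps `Re ω₀[K_μ + κW_R](W_R) ≥ c L²` eventually along even sides (`ω₀` the tracial ground-state functional
of the block-repelled grand-canonical Hubbard torus; no source, no order of limits). It is OPEN PHYSICS, NOT filed as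
an item, and appears here only as the antecedent. The consequent is the registered signature of `stub_facePurity`
(line `pair-yrast-landau-floor`) VERBATIM. [folklore] -/
theorem stub_facePurity_of_repelledCoherence :
    (∀ (U δ μ : ℝ), 0 < U → δ ∈ Set.Ioo (0:ℝ) 1 → Filter.Tendsto (fun L : ℕ => ((hubbardTorusWith 2 (L + 1) 1 U μ).groundStateFunctional totalNumber).re / ((L + 1 : ℕ) : ℝ) ^ 2) Filter.atTop (nhds (1 - δ)) → HasDWaveOrder U μ → ∃ c : ℝ, 0 < c ∧ ∀ R : ℕ, 0 < R → ∃ κ : ℝ, 0 < κ ∧ ∀ᶠ k : ℕ in Filter.atTop, c * ((2 * k + 1 + 1 : ℕ) : ℝ) ^ 2 ≤ ((hubbardTorusWith 2 (2 * k + 1 + 1) 1 U μ + (κ : ℂ) • (((((R : ℝ) ^ 4)⁻¹ : ℝ) : ℂ) • ∑ a : Literature.Probability.LatticeModels.TorusSite 2 (2 * k + 1 + 1), (∑ u : Fin 2 → Fin R, localPair dWaveFormFactor (2 * k + 1 + 1) (a + fun i => ((u i : ℕ) : ZMod (2 * k + 1 + 1))))ᴴ * (∑ u : Fin 2 → Fin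 R, localPair dWaveFormFactor (2 * k + 1 + 1) (a + fun i => ((u i : ℕ) : ZMod (2 * k + 1 + 1)))))).groundStateFunctional (((((R : ℝ) ^ 4)⁻¹ : ℝ) : ℂ) • ∑ a : Literature.Probability.LatticeModels.TorusSite 2 (2 * k + 1 + 1), (∑ u : Fin 2 → Fin R, localPair dWaveFormFactor (2 * k + 1 + 1) (a + fun i => ((u i : ℕ) : ZMod (2 * k + 1 + 1))))ᴴ * (∑ u : Fin 2 → Fin R, localPair dWaveFormFactor (2 * k + 1 + 1) (a + fun i => ((u i : ℕ) : ZMod (2 * k + 1 + 1)))))).re) → ∀ (U δ μ : ℝ), 0 < U → δ ∈ Set.Ioo (0:ℝ) 1 → Filter.Tendsto (fun L : ℕ => ((hubbardTorusWith 2 (L + 1) 1 U μ).groundStateFunctional totalNumber).re / ((L + 1 : ℕ) : ℝ) ^ 2) Filter.atTop (nhds (1 - δ)) → HasDWaveOrder U μ → ∃ a : ℝ, 0 < a ∧ ∀ R : ℕ, 0 < R → ∀ᶠ k : ℕ in Filter.atTop, ∀ ψ : Fock (Orb (FermionTorus 2 (2 * k + 1 + 1))), IsGroundStateInSector (hubbardTorus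 2 (2 * k + 1 + 1) 1 U) (2 * ⌊(1 - δ) * ((2 * k + 1 + 1 : ℕ) : ℝ) ^ 2 / 2⌋₊) 0 ψ → star ψ ⬝ᵥ ψ = 1 → a * ((2 * k + 1 + 1 : ℕ) : ℝ) ^ 2 ≤ (star ψ ⬝ᵥ ((((((R : ℝ) ^ 4)⁻¹ : ℝ) : ℂ) • ∑ x : TorusSite 2 (2 * k + 1 + 1), (∑ u : Fin 2 → Fin R, localPair dWaveFormFactor (2 * k + 1 + 1) (x + fun i => ((u i : ℕ) : ZMod (2 * k + 1 + 1))))ᴴ * (∑ u : Fin 2 → Fin R, localPair dWaveFormFactor (2 * k + 1 + 1) (x + fun i => ((u i : ℕ) : ZMod (2 * k + 1 + 1))))) *ᵥ ψ)).re :=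
  fun hC U δ μ hU hδ hdm hO => facePurity_of_repelledCoherenceAt hδ hdm (hC U δ μ hU hδ hdm hO)

/-! ## Door 4 of the line: the crux BY NAME from repelled pair coherence and the infrared ceiling -/

/-- **Crux glue, door 4: (RPC) ∧ (infrared ceiling) ⇒ `SsbToEvenTorusLro`.** The every-ground-state half supplied by
the source-free tracial repelled-pair-coherence floor (this file), the infrared half by the Goldstone-shape ceiling
`S_ψ(m) ≤ A|q_m|^{-α}` (`α < 2`) on the punctured window of every sector ground state (registered open stub
`stub_infraredCeiling`; landed door 3 `SsbToEvenTorusLro_of_facePurity_of_infraredCeiling`). [folklore] -/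
theorem SsbToEvenTorusLro_of_repelledCoherence_of_infraredCeiling
    (hRPC : ∀ (U δ μ : ℝ), 0 < U → δ ∈ Set.Ioo (0:ℝ) 1 → Filter.Tendsto (fun L : ℕ => ((hubbardTorusWith 2 (L + 1) 1 U μ).groundStateFunctional totalNumber).re / ((L + 1 : ℕ) : ℝ) ^ 2) Filter.atTop (nhds (1 - δ)) → HasDWaveOrder U μ → ∃ c : ℝ, 0 < c ∧ ∀ R : ℕ, 0 < R → ∃ κ : ℝ, 0 < κ ∧ ∀ᶠ k : ℕ in Filter.atTop, c * ((2 * k + 1 + 1 : ℕ) : ℝ) ^ 2 ≤ ((hubbardTorusWith 2 (2 * k + 1 + 1) 1 U μ + (κ : ℂ) • (((((R : ℝ) ^ 4)⁻¹ : ℝ) : ℂ) • ∑ a : Literature.Probability.LatticeModels.TorusSite 2 (2 * k + 1 + 1), (∑ u : Fin 2 → Fin R, localPair dWaveFormFactor (2 * k + 1 + 1) (a + fun i => ((u i : ℕ) : ZMod (2 * k + 1 + 1))))ᴴ * (∑ u : Fin 2 → Fin R, localPair dWaveFormFactor (2 * k + 1 + 1) (a + fun i => ((u i : ℕ) : ZMod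 (2 * k + 1 + 1)))))).groundStateFunctional (((((R : ℝ) ^ 4)⁻¹ : ℝ) : ℂ) • ∑ a : Literature.Probability.LatticeModels.TorusSite 2 (2 * k + 1 + 1), (∑ u : Fin 2 → Fin R, localPair dWaveFormFactor (2 * k + 1 + 1) (a + fun i => ((u i : ℕ) : ZMod (2 * k + 1 + 1))))ᴴ * (∑ u : Fin 2 → Fin R, localPair dWaveFormFactor (2 * k + 1 + 1) (a + fun i => ((u i : ℕ) : ZMod (2 * k + 1 + 1)))))).re)
    (hIR : ∀ (U δ μ : ℝ), 0 < U → δ ∈ Set.Ioo (0:ℝ) 1 → Filter.Tendsto (fun L : ℕ => ((hubbardTorusWith 2 (L + 1) 1 U μ).groundStateFunctional totalNumber).re / ((L + 1 : ℕ) : ℝ) ^ 2) Filter.atTop (nhds (1 - δ)) → HasDWaveOrder U μ → ∃ A α η : ℝ, α < 2 ∧ 0 < η ∧ ∀ᶠ k : ℕ in Filter.atTop, ∀ ψ : Fock (Orb (FermionTorus 2 (2 * k + 1 + 1))), IsGroundStateInSector (hubbardTorus 2 (2 * k + 1 + 1) 1 U) (2 * ⌊(1 - δ) * ((2 * k + 1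 + 1 : ℕ) : ℝ) ^ 2 / 2⌋₊) 0 ψ → star ψ ⬝ᵥ ψ = 1 → ∀ m : TorusSite 2 (2 * k + 1 + 1), m ≠ 0 → momentumNormSq (2 * k + 1 + 1) m ≤ η ^ 2 → pairStructureFactor dWaveFormFactor (2 * k + 1 + 1) ψ m ≤ A * (momentumNormSq (2 * k + 1 + 1) m ^ (α / 2))⁻¹) :
    SsbToEvenTorusLro :=
  SsbToEvenTorusLro_of_facePurity_of_infraredCeiling (stub_facePurity_of_repelledCoherence hRPC) hIR

end Summit.HubbardSuperconductivity.HubbardSuperconductivity.Theorems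

end
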